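import Mathlib
import HarnessLib
import Summits.HubbardSuperconductivity.HubbardSuperconductivity.Theorems.KLProgrammeFermiSurfaceCertWindow
import Summits.HubbardSuperconductivity.HubbardSuperconductivity.Theorems.KLProgrammeFermiSurfaceExtDopingForm
import Summits.HubbardSuperconductivity.HubbardSuperconductivity.Theorems.WeakCouplingBCSWcbcsKohnLuttingerB1gFormAWindowD010D025

/-!
# Route `KLProgramme` / `WeakCouplingBCS` — risk-register item r2 «Fermi-surface hypotheses» AS `δ`-THEOREMS on the
# certificate's form-(A) doping window `δ ∈ [0.10, 0.25]` (`μ(δ) ∈ [-0.5725, -0.1775]`)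

Cell `gate-hubbard-kl`, seat fs-1 (g7); companion of `KLProgrammeFermiSurfaceCertWindow.lean`. The certificate half of R2d is
read in form (A) on `δ ∈ [0.10, 0.25]` since cert-3's `WeakCouplingBCSWcbcsKohnLuttingerB1gFormAWindowD010D025.lean`, whose
UNCONDITIONAL link `muOfDoping_mem_window_d010_d025 : δ ∈ [0.10, 0.25] ⇒ μ(δ) ∈ [-0.5725, -0.1775]` (two certified window-end
fillings + monotonicity) is composed here — one owner each: the link is cert-3's, the rows are fs-1's — with the `μ`-rows of
`…CertWindow.lean` (numeric rows, binding end `δ = 0.10`) and of `…ExtWindow.lean` (qualitative rows, by inclusion):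

* for every `δ ∈ [0.10, 0.25]`, at `μ = μ(δ)`: `μ(δ) ∈ [-0.5725, -0.1775] ⊂ [-1, -0.15]`, `-2 < μ(δ) < 0`; `v_F = ‖∇ε₀‖ ≥ 0.8237`,
  `∇ε₀ ≠ 0`, `0.0313 ≤ κ ≤ 2.43`, nesting defect `≥ 0.355` (`klfs_doping1025_geometry`) — THE SAME CONSTANTS AS ON THE WINDOW OF
  RECORD `[0.10, 0.20]` (`…DopingForm.lean` §1), because the binding end is `δ = 0.10`; FST II (A1)–(A4), (Sy), (A3) global HOLD and
  (A5) FAILS with the `(1,0)` umklapp quadruple, a pair `p + q ∉` Brillouin zone and the `(1,0)`-corner (`klfs_doping1025_fst2_umklapp`);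
  corner transversality `≥ 0.1018`; `GeomConstants e 4.5725 0.0887 0.575 0.0443` and FST III `Admits M ⟨0, 42, normV, 0.574, 0.0887,
  0.0443⟩` + (H1)–(H4), `¬(H5)`; FST IV / BGM 2006 / FKT 2004 exclude, Salmhofer 1998 admits; BGM 2003 with `e₀ = 0.08`;
  `∂ₜF ≥ 0.8236`; ONE two-loop `Q`; the SHARP `BandBounds (-0.5725) (-0.1775)` bundle (`C_g ≤ 102`) covers every `μ(δ)`.

No definitions; everything PROVED (compositions). [folklore]
-/

noncomputable section

open Real Set

-- the tree's namespace `Summit.<Summit>.<Problem>.Theorems` repeats the summit name by design (D-0017)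
set_option linter.dupNamespace false

namespace Summit.HubbardSuperconductivity.HubbardSuperconductivity.Theorems

open Literature.MathematicalPhysics.QuantumLattice
open Literature.MathematicalPhysics.QuantumLattice.BandSectorCounting

/-! ### §0 The link (cert-3's) and its corollaries -/

/-- **`μ(δ) ∈ [-0.5725, -0.1775]` for `δ ∈ [0.10, 0.25]`** (cert-3's `muOfDoping_mem_window_d010_d025`), hence `μ(δ)` lies in the
extended window `[-0.5725, -0.075]` and in the analysis window `[-1, -0.15]`, and `-2 < μ(δ) < 0`. [folklore] -/
theorem klfs_muOfDoping_mem_cwin {δ : ℝ} (hδ : δ ∈ Icc (0.10 : ℝ) 0.25) :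
    chemicalPotentialOfDensity (squareDispersion 1 0) (1 - δ) ∈ Icc (-0.5725 : ℝ) (-0.1775) ∧
    (chemicalPotentialOfDensity (squareDispersion 1 0) (1 - δ) ∈ Icc (-0.5725 : ℝ) (-0.075) ∧
      chemicalPotentialOfDensity (squareDispersion 1 0) (1 - δ) ∈ Icc (-1 : ℝ) (-0.15)) ∧
    -2 < chemicalPotentialOfDensity (squareDispersion 1 0) (1 - δ) ∧
    chemicalPotentialOfDensity (squareDispersion 1 0) (1 - δ) < 0 := by
  have h := muOfDoping_mem_window_d010_d025 δ hδ
  exact ⟨h, klfs_cwin_xwin h, klfs_cwin_sub h⟩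

/-! ### §1 The rows at `μ(δ)`, `δ ∈ [0.10, 0.25]` -/

/-- **Speed, curvature, nesting at `μ(δ)`, `δ ∈ [0.10, 0.25]`**: on the Fermi curve `{ε₀ = μ(δ)}`, `∇ε₀ ≠ 0` and
`‖∇ε₀‖ ≥ 0.8237`; at every level point `-2(cos x + cos y) = μ(δ)` the curvature lies in `[0.0313, 2.43]`; the `(π,π)` nesting
defect is `≥ 0.355` (the constants of the window of record `[0.10, 0.20]`). [folklore] -/
theorem klfs_doping1025_geometry {δ : ℝ} (hδ : δ ∈ Icc (0.10 : ℝ) 0.25) :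
    (∀ k ∈ fermiCurve (squareDispersion 1 0) (chemicalPotentialOfDensity (squareDispersion 1 0) (1 - δ)),
      gradient (squareDispersion 1 0) k ≠ 0 ∧ (0.8237 : ℝ) ≤ ‖gradient (squareDispersion 1 0) k‖) ∧
    (∀ x y : ℝ, -2 * (Real.cos x + Real.cos y) = chemicalPotentialOfDensity (squareDispersion 1 0) (1 - δ) →
      (Real.cos x * Real.sin y ^ 2 + Real.cos y * Real.sin x ^ 2) /
        ((Real.sin x ^ 2 + Real.sin y ^ 2) * Real.sqrt (Real.sin x ^ 2 + Real.sin y ^ 2)) ∈ Icc (0.0313 : ℝ) 2.43) ∧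
    (∀ k : Fin 2 → ℝ, sqDispersion k = chemicalPotentialOfDensity (squareDispersion 1 0) (1 - δ) →
      (0.355 : ℝ) ≤ |sqDispersion (fun i => k i + π) - chemicalPotentialOfDensity (squareDispersion 1 0) (1 - δ)|) := by
  have hμ := (klfs_muOfDoping_mem_cwin hδ).1
  exact ⟨fun k hk => ⟨klfs_cwin_gradient_ne_zero hμ hk, klfs_cwin_norm_gradient_ge hμ hk⟩,
    fun x y h => klfs_cwin_curvature hμ h, fun k hk => klfs_cwin_nesting_defect hμ hk⟩

/-- **FST II's hypotheses at `μ(δ)`, `δ ∈ [0.10, 0.25]`: (A1)–(A4), (Sy), (A3) global HOLD, (A5) FAILS** — with the explicit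
`(1,0)` umklapp quadruple on the Fermi curve, a pair `p + q ∉` Brillouin zone, and the `(1,0)`-corner `3 p(θ*) ∈ F + 2π(1,0)`,
`0 < θ* < π/4` («A5 fails ⇒ C4b is load-bearing» on the certificate's whole form-(A) window). [folklore] -/
theorem klfs_doping1025_fst2_umklapp {δ : ℝ} (hδ : δ ∈ Icc (0.10 : ℝ) 0.25) (U : ℝ) (k : ℕ) :
    (FermiRG.HypA1 (FermiRG.Crystal.cubic 2) k 0 (fun _ : ℝ × Momentum => (U : ℂ)) ∧
      FermiRG.HypA2 (FermiRG.Crystal.cubic 2) k 0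
        (fun q : Momentum => squareDispersion 1 0 q - chemicalPotentialOfDensity (squareDispersion 1 0) (1 - δ)) ∧
      FermiRG.HypA3 (fun q : Momentum => squareDispersion 1 0 q - chemicalPotentialOfDensity (squareDispersion 1 0) (1 - δ)) ∧
      FermiRG.HypA3Global (FermiRG.Crystal.cubic 2)
        (fun q : Momentum => squareDispersion 1 0 q - chemicalPotentialOfDensity (squareDispersion 1 0) (1 - δ)) ∧
      FermiRG.HypA4 (FermiRG.Crystal.cubic 2)
        (fun q : Momentum => squareDispersion 1 0 q - chemicalPotentialOfDensity (squareDispersion 1 0) (1 - δ)) ∧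
      FermiRG.HypSy (fun p : Momentum => squareDispersion 1 0 p - chemicalPotentialOfDensity (squareDispersion 1 0) (1 - δ))) ∧
    ¬ FermiRG.HypA5 (FermiRG.Crystal.cubic 2)
        (fun q : Momentum => squareDispersion 1 0 q - chemicalPotentialOfDensity (squareDispersion 1 0) (1 - δ)) ∧
    (∃ kk : Fin 4 → Fin 2 → ℝ, (∀ j i, |kk j i| < π) ∧
      (∀ j, sqDispersion (kk j) = chemicalPotentialOfDensity (squareDispersion 1 0) (1 - δ)) ∧
      (![(1 : ℤ), 0] : Fin 2 → ℤ) ≠ 0 ∧ ∀ i, ∑ j, kk j i = 2 * π * ((![(1 : ℤ), 0] : Fin 2 → ℤ) i : ℝ)) ∧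
    (∃ p q : Momentum, p ∈ fermiCurve (squareDispersion 1 0) (chemicalPotentialOfDensity (squareDispersion 1 0) (1 - δ)) ∧
      q ∈ fermiCurve (squareDispersion 1 0) (chemicalPotentialOfDensity (squareDispersion 1 0) (1 - δ)) ∧
      p + q ∉ brillouinZone) ∧
    (∃ θ ∈ Ioo (0 : ℝ) (π / 4),
      rayDispersion (θ, 3 * bandFermiRadius (chemicalPotentialOfDensity (squareDispersion 1 0) (1 - δ)) θ) =
        chemicalPotentialOfDensity (squareDispersion 1 0) (1 - δ) ∧
      π < ‖(3 * bandFermiRadius (chemicalPotentialOfDensity (squareDispersion 1 0) (1 - δ)) θ) • dir θ‖) :=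
  klfs_xdoping_fst2_umklapp (klfs_xdoping_of_sub (Or.inr hδ)) U k

/-- **Corner transversality at `μ(δ)`, `δ ∈ [0.10, 0.25]`**: at the `(1,0)`-corner, `sin²x₁ - sin²y₁ ≥ 0.1018` (true minimum
`0.10238` at `δ = 0.10`, as on the window of record). [folklore] -/
theorem klfs_doping1025_corner_transversality_factor_ge {δ : ℝ} (hδ : δ ∈ Icc (0.10 : ℝ) 0.25) {θ : ℝ}
    (hθ : θ ∈ Ioo (0 : ℝ) (π / 4))
    (hcorner : rayDispersion (θ, 3 * bandFermiRadius (chemicalPotentialOfDensity (squareDispersion 1 0) (1 - δ)) θ) =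
      chemicalPotentialOfDensity (squareDispersion 1 0) (1 - δ)) :
    (0.1018 : ℝ) ≤ Real.sin (bandX (chemicalPotentialOfDensity (squareDispersion 1 0) (1 - δ)) θ) ^ 2 -
      Real.sin (bandY (chemicalPotentialOfDensity (squareDispersion 1 0) (1 - δ)) θ) ^ 2 :=
  klfs_cwin_corner_transversality_factor_ge (klfs_muOfDoping_mem_cwin hδ).1 hθ hcorner

/-- **The typed hypothesis sets at `μ(δ)`, `δ ∈ [0.10, 0.25]`**: FST II `GeomConstants e 4.5725 0.0887 0.575 0.0443`; FST III:
ONE datum `Admits M ⟨0, 42, normV, 0.574, 0.0887, 0.0443⟩` for any record carrying the band at `μ(δ)` with `v̂ ≡ U`,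
`|U| ≤ normV`, the hypotheses (H1)–(H4) of Thm 1.2, and `¬(H5)` on the crystal's cell. [folklore] -/
theorem klfs_doping1025_fst_constants {δ : ℝ} (hδ : δ ∈ Icc (0.10 : ℝ) 0.25) :
    FermiRG.GeomConstants
        (fun q : Momentum => squareDispersion 1 0 q - chemicalPotentialOfDensity (squareDispersion 1 0) (1 - δ))
        4.5725 0.0887 0.575 0.0443 ∧
    ∀ (M : FermiRG.FST3.Model 2),
      (M.e = fun p : Momentum => squareDispersion 1 0 p - chemicalPotentialOfDensity (squareDispersion 1 0) (1 - δ)) →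
      ∀ {U : ℝ}, (M.vhat = fun _ => (U : ℂ)) → ∀ {normV : ℝ}, |U| ≤ normV →
        FermiRG.FST3.Admits M ⟨0, 42, normV, 0.574, 0.0887, 0.0443⟩ ∧
        (FermiRG.FST3.H1 2 0 M ∧ FermiRG.FST3.H2 2 0 M ∧ FermiRG.FST3.H3 M ∧ FermiRG.FST3.H4 M) ∧
        (M.fund = (FermiRG.Crystal.cubic 2).fundamentalDomain → ¬ FermiRG.FST3.H5 M) := by
  have hμ := (klfs_muOfDoping_mem_cwin hδ).1
  exact ⟨klfs_cwin_geomConstants hμ, fun M he U hv normV hV => klfs_cwin_fst3 hμ M he hv hV⟩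

/-- **The classes at `μ(δ)`, `δ ∈ [0.10, 0.25]`**: FST IV's inversion class EXCLUDES the band for every fundamental cell and all
constants; BGM 2006's regime and `e₀`-admissibility fail and Lemma 2.1 clause (3) is false at `h = 0`; FKT 2004's hypotheses
fail; Salmhofer 1998 §2.3 `ModelData.Hyp` HOLDS. [folklore] -/
theorem klfs_doping1025_classes {δ : ℝ} (hδ : δ ∈ Icc (0.10 : ℝ) 0.25) :
    (∀ (L : FermiRG.FST4.LatticeData 2), L.latt = ((FermiRG.Crystal.cubic 2).dualLattice : Set Momentum) →
      (∀ z ∈ L.fund, ∀ w ∈ L.fund, z - w ∈ L.latt → z = w) → ∀ δ₀ g₀ G₀ w₀ : ℝ,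
      ¬ FermiRG.FST4.InDispersionClass L δ₀ g₀ G₀ w₀
        (fun p : Momentum => squareDispersion 1 0 p - chemicalPotentialOfDensity (squareDispersion 1 0) (1 - δ))) ∧
    (¬ (chemicalPotentialOfDensity (squareDispersion 1 0) (1 - δ) < -2 - Real.sqrt 2) ∧
      ∀ e₀ : ℝ, ¬ FermiRG.BGMAdmissibleE0 (chemicalPotentialOfDensity (squareDispersion 1 0) (1 - δ)) e₀) ∧
    (∀ {E : ℤ → ℝ × (Fin 2 → ℝ) → ℂ}, FermiRG.BGMInitial E → ∀ β : ℝ,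
      ∃ k : Fin (2 * 2) → Fin 2 → ℝ, (∀ j, k j ∈ FermiRG.zoneSq ∧
        FermiRG.bgmEffDisp β E 0 (k j) = chemicalPotentialOfDensity (squareDispersion 1 0) (1 - δ) + 0) ∧
        ¬ Real.sqrt ((∑ j, k j 0) ^ 2 + (∑ j, k j 1) ^ 2) < 2 * π) ∧
    (∀ (D : FermiRG.FKT2004.FermiCurveData),
      (D.e = fun k : Momentum => squareDispersion 1 0 k - chemicalPotentialOfDensity (squareDispersion 1 0) (1 - δ)) →
      ∀ r : ℕ, ¬ FermiRG.FKT2004.Hypotheses r D) ∧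
    (∀ (U : ℝ) {k₀ : ℕ}, 2 ≤ k₀ → ∀ {ε₀ : ℝ}, 0 < ε₀ → ε₀ ≤ 1 →
      (FermiRG.Salmhofer1998.ModelData.mk 1
        (fun p : Fin 2 → ℝ => sqDispersion p - chemicalPotentialOfDensity (squareDispersion 1 0) (1 - δ))
        (fun _ _ => U) (fun _ => U) k₀ ε₀ : FermiRG.Salmhofer1998.ModelData 2).Hyp) :=
  klfs_xdoping_classes (klfs_xdoping_of_sub (Or.inr hδ))

/-- **BGM 2003 at `μ(δ)`, `δ ∈ [0.10, 0.25]`, shell width `e₀ = 0.08`** (the window of record's shell): §1.2 `DispersionHyp`, the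
lattice class `LatticeModelHyp` (finitely supported pair potentials), and Lemma 3.1 (4.3) sector counting for the Hubbard band.
[folklore] -/
theorem klfs_doping1025_bgm2003 {δ : ℝ} (hδ : δ ∈ Icc (0.10 : ℝ) 0.25) :
    FermiRG.BGM2003.DispersionHyp sqDispersion (chemicalPotentialOfDensity (squareDispersion 1 0) (1 - δ)) 0.08
        (fun θ e => bandFermiRadius (chemicalPotentialOfDensity (squareDispersion 1 0) (1 - δ) + e) θ) ∧
    (∀ (v : Fin 2 → Fin 2 → Literature.Probability.LatticeModels.Site 2 → ℝ),
      (∀ σ σ' : Fin 2, (Function.support (v σ σ')).Finite) →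
      FermiRG.BGM2003.LatticeModelHyp (fun k => sqDispersion k + 4)
        (chemicalPotentialOfDensity (squareDispersion 1 0) (1 - δ) + 4) 0.08
        (fun θ e => bandFermiRadius (chemicalPotentialOfDensity (squareDispersion 1 0) (1 - δ) + e) θ) v) ∧
    (∃ c : ℝ, 0 < c ∧ ∀ (n n' : ℕ), n ≤ n' →
      (∀ (L : ℕ) (i₁ : Fin L) (ω₁ : ℕ) (ωt : Fin L → ℕ), 4 ≤ L → ω₁ < sectorCount n' →
          (∀ i, ωt i < sectorCount n) →
          (Nat.card (FermiRG.BGM2003.sectorStrings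
              (fun ϑ e' => bandFermiRadius (chemicalPotentialOfDensity (squareDispersion 1 0) (1 - δ) + e') ϑ)
              0.08 n n' L i₁ ω₁ ωt) : ℝ) ≤ c ^ L * (2 : ℝ) ^ ((n' - n) * (L - 3))) ∧
      (∀ (i₁ : Fin 2) (ω₁ : ℕ) (ωt : Fin 2 → ℕ), ω₁ < sectorCount n' → (∀ i, ωt i < sectorCount n) →
          (Nat.card (FermiRG.BGM2003.sectorStrings
              (fun ϑ e' => bandFermiRadius (chemicalPotentialOfDensity (squareDispersion 1 0) (1 - δ) + e') ϑ)
              0.08 n n' 2 i₁ ω₁ ωt) : ℝ) ≤ c)) :=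
  klfs_cwin_bgm2003 (klfs_muOfDoping_mem_cwin hδ).1

/-- **Radial transversality at `μ(δ)`, `δ ∈ [0.10, 0.25]`**: `∂ₜF(θ, u(θ)) ≥ 0.8236` at every angle. [folklore] -/
theorem klfs_doping1025_rayDispersionDt_ge {δ : ℝ} (hδ : δ ∈ Icc (0.10 : ℝ) 0.25) (θ : ℝ) :
    (0.8236 : ℝ) ≤ rayDispersionDt θ (bandFermiRadius (chemicalPotentialOfDensity (squareDispersion 1 0) (1 - δ)) θ) :=
  klfs_cwin_rayDispersionDt_ge (klfs_muOfDoping_mem_cwin hδ).1 θ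

/-- **ONE two-loop constant for `δ ∈ [0.10, 0.25]`** (FST II Thm 1.1, `d = 2`): `∃ Q ≥ 1` with `𝓦(ε') ≤ Q ε' |log ε'|` at `μ(δ)`
for every `δ ∈ [0.10, 0.25]` and `0 < ε' ≤ 1/2`. [folklore] -/
theorem klfs_doping1025_volW_le :
    ∃ Q : ℝ, 1 ≤ Q ∧ ∀ δ ∈ Icc (0.10 : ℝ) 0.25, ∀ ε' : ℝ, 0 < ε' → ε' ≤ 1 / 2 →
      FermiRG.volW (FermiRG.Crystal.cubic 2)
        (fun q : Momentum => squareDispersion 1 0 q - chemicalPotentialOfDensity (squareDispersion 1 0) (1 - δ)) ε' ≤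
        ENNReal.ofReal (Q * ε' * |Real.log ε'|) := by
  obtain ⟨Q, hQ, h⟩ := klfs_xdoping_volW_le
  exact ⟨Q, hQ, fun δ hδ ε' hε hε2 => h δ (klfs_xdoping_of_sub (Or.inr hδ)) ε' hε hε2⟩

/-- **The SHARP `BandBounds` bundle covers every `μ(δ)`, `δ ∈ [0.10, 0.25]`**: ONE `BandBounds (-0.5725) (-0.1775)` with
`umin ≥ 2.018`, `smax ≤ 3.85`, `A2 ≤ 33.2`, `hmin ≥ 0.183`, `amin ≥ 0.0633`, `rhomin ≥ 0.4118`, `cmax ≤ 0.694`, `Dtmin ≥ 0.8236`,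
`C_g ≤ 102`, `Dcell ≤ 3.14`, whose level range contains `μ(δ)` for every `δ` of the certificate's form-(A) window. [folklore] -/
theorem klfs_doping1025_sharpBandBounds :
    ∃ B : BandBounds (-0.5725) (-0.1775),
      (2.018 ≤ B.umin ∧ B.smax ≤ 3.85 ∧ B.A2 ≤ 33.2 ∧ 0.183 ≤ B.hmin ∧ 0.0633 ≤ B.amin ∧ 0.4118 ≤ B.rhomin ∧
        B.cmax ≤ 0.694 ∧ 0.8236 ≤ B.Dtmin ∧ B.Cg ≤ 102 ∧ B.Dcell ≤ 3.14) ∧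
      ∀ δ ∈ Icc (0.10 : ℝ) 0.25, chemicalPotentialOfDensity (squareDispersion 1 0) (1 - δ) ∈ Icc (-0.5725 : ℝ) (-0.1775) := by
  obtain ⟨B, hB⟩ := klfs_cwin_sharpBandBounds
  exact ⟨B, hB, fun δ hδ => (klfs_muOfDoping_mem_cwin hδ).1⟩

/-! ### §2 The headline in one statement -/

/-- **Risk-register item r2 on the certificate's form-(A) window, headline form**: for every `δ ∈ [0.10, 0.25]` the free band at
`μ(δ)` has a non-degenerate (`‖∇ε₀‖ ≥ 0.8237`), strictly convex (`κ ≥ 0.0313`) Fermi curve with no `(π,π)` nesting (defect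
`≥ 0.355`), FST II's (A5) FAILS (umklapp present) and the `(1,0)`-corner exists with transversality factor `≥ 0.1018` — the
conjunction the typed FST/BGM statements and DECOMP's C4b consume, with the constants of the window of record. [folklore] -/
theorem klfs_doping1025_headline {δ : ℝ} (hδ : δ ∈ Icc (0.10 : ℝ) 0.25) :
    (∀ k ∈ fermiCurve (squareDispersion 1 0) (chemicalPotentialOfDensity (squareDispersion 1 0) (1 - δ)),
      (0.8237 : ℝ) ≤ ‖gradient (squareDispersion 1 0) k‖) ∧
    (∀ x y : ℝ, -2 * (Real.cos x + Real.cos y) = chemicalPotentialOfDensity (squareDispersion 1 0) (1 - δ) →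
      (0.0313 : ℝ) ≤ (Real.cos x * Real.sin y ^ 2 + Real.cos y * Real.sin x ^ 2) /
        ((Real.sin x ^ 2 + Real.sin y ^ 2) * Real.sqrt (Real.sin x ^ 2 + Real.sin y ^ 2))) ∧
    (∀ k : Fin 2 → ℝ, sqDispersion k = chemicalPotentialOfDensity (squareDispersion 1 0) (1 - δ) →
      (0.355 : ℝ) ≤ |sqDispersion (fun i => k i + π) - chemicalPotentialOfDensity (squareDispersion 1 0) (1 - δ)|) ∧
    ¬ FermiRG.HypA5 (FermiRG.Crystal.cubic 2)
        (fun q : Momentum => squareDispersion 1 0 q - chemicalPotentialOfDensity (squareDispersion 1 0) (1 - δ)) ∧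
    (∃ θ ∈ Ioo (0 : ℝ) (π / 4),
      rayDispersion (θ, 3 * bandFermiRadius (chemicalPotentialOfDensity (squareDispersion 1 0) (1 - δ)) θ) =
        chemicalPotentialOfDensity (squareDispersion 1 0) (1 - δ) ∧
      π < ‖(3 * bandFermiRadius (chemicalPotentialOfDensity (squareDispersion 1 0) (1 - δ)) θ) • dir θ‖) ∧
    (∀ θ ∈ Ioo (0 : ℝ) (π / 4),
      rayDispersion (θ, 3 * bandFermiRadius (chemicalPotentialOfDensity (squareDispersion 1 0) (1 - δ)) θ) =
        chemicalPotentialOfDensity (squareDispersion 1 0) (1 - δ) →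
      (0.1018 : ℝ) ≤ Real.sin (bandX (chemicalPotentialOfDensity (squareDispersion 1 0) (1 - δ)) θ) ^ 2 -
        Real.sin (bandY (chemicalPotentialOfDensity (squareDispersion 1 0) (1 - δ)) θ) ^ 2) := by
  obtain ⟨hg, hκ, hn⟩ := klfs_doping1025_geometry hδ
  obtain ⟨-, hA5, -, -, hc⟩ := klfs_doping1025_fst2_umklapp hδ 0 0
  exact ⟨fun k hk => (hg k hk).2, fun x y h => (hκ x y h).1, hn, hA5, hc,
    fun θ hθ hcor => klfs_doping1025_corner_transversality_factor_ge hδ hθ hcor⟩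

end Summit.HubbardSuperconductivity.HubbardSuperconductivity.Theorems

end
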